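import Summits.AnomalousDissipation.AnomalousDissipation.Theses.DopplerClock
import Summits.AnomalousDissipation.AnomalousDissipation.Theorems.ImpulseGridGridThesisStubAcdcDesignCalculus

/-!
# Route DopplerClock (AnomalousDissipation) — support item `DopplerWorkIdentity`
# (stmt-AnomalousDissipation-18133): the two-mode rotation identity

For the swept Doppler pair `f = F sin(2πm x₁) cos(2πn x₂) e₀ = (F · Im e_M · Re e_N) e₀`
(`e_k = UnitAddTorus.mFourier k`, `M = m e₁`, `N = n e₂` in `ℤ³`), the quadrature streak pattern
`Ψ_s = sin(2πm x₁) sin(2πn x₂) e₀ = (Im e_M · Im e_N) e₀`, a drift `V > 0`, `ν > 0`, `n ≥ 1`, every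
global Leray–Hopf solution `u` of `NS_ν` forced by `f` with `sup_{t ≥ 0} ½‖u(t)‖₂² < ∞`, and every
generalized (Banach) long-time limit `Λ`:

`Λ⟨(f, u)⟩ = F / (V · 2πn) · (ν κ² Λ⟨(Ψ_s, u)⟩ − Λ⟨T_s(w)⟩)`,
`κ² = 4π²(m² + n²)`, `w = u − V e₂`, `T_s(w) = ∫ ⟪w, (w·∇)Ψ_s⟫`.

**Proof.** The mean momentum balance of route ImpulseGrid
(`meanMomentumBalance_proof`, item stmt-AnomalousDissipation-1773: for a steady smooth force, a
smooth divergence-free steady test field `Φ₀` and a global Leray–Hopf solution with sup-bounded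
kinetic energy, `Λ⟨∫⟪u,(u·∇)Φ₀⟫⟩ + ν Λ⟨∫⟪u,ΔΦ₀⟫⟩ + ∫⟪f,Φ₀⟫ = 0` — the time-sliced weak
formulation, Cesàro-averaged, boundary terms `O(1/T)`) is tested with `Φ₀ := Ψ_s`, which is
`½ (Re e_{M−N} − Re e_{M+N}) e₀`, a combination of two cosine Stokes modes of the shell
`|k|² = m² + n²` with transversal amplitude (`e₀ ⊥ M ± N`): smooth, divergence free,
`ΔΨ_s = −κ² Ψ_s`. The force pairing vanishes, `∫⟪f, Ψ_s⟫ = F ∫ sin² cos·sin = 0` (the integrand is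
`F/4 · Im e_{2N} − F/8 · (Im e_{2N+2M} + Im e_{2N−2M})` and `∫ Im e_k = 0` for every `k`). The
Galilean pointwise algebra `⟪u,(u·∇)Ψ_s⟫ = ⟪w,(w·∇)Ψ_s⟫ + V ⟪u, ∂₂Ψ_s⟫`
(`GridInjection.inner_convect_eq_shift`, the `e₂`-components of `(w·∇)Ψ_s` and `∂₂Ψ_s` vanish)
with `∂₂Ψ_s = 2πn Ψ_c`, `Ψ_c = (Im e_M · Re e_N) e₀`, and linearity of `Λ⟨·⟩` on interval-integrable
functions (`GridInjection.longTimeAvg_add/const_mul`) give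
`Λ⟨T_s(w)⟩ + 2πnV Λ⟨(u,Ψ_c)⟩ − νκ² Λ⟨(Ψ_s,u)⟩ = 0`; finally `(f, u) = F (u, Ψ_c)`.
The momentum hypothesis `∫ u₀ = V e₂` of the item is not needed (the fluctuation `w := u − V e₂`
is defined by formula).

References: Foias–Manley–Rosa–Temam 2001, Ch. IV §3.1 (bookkeeping of body-forced Navier–Stokes in
generalized limits); Doering–Foias 2002 §2; Alexakis–Doering 2006 §2 (the multiplier argument);
Constantin–Foias 1988, Ch. 4 (4.13)–(4.14), (4.33) (Stokes eigenfields); Grafakos 2014, Prop. 3.2.6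
(derivatives of characters). No new definitions.
-/

noncomputable section

-- `Summit.<Summit>.<Problem>` is the tree's mandated summit-side namespace (CONVENTIONS §2); for this
-- single-conjunct summit the two coincide, so the duplicate is deliberate.
set_option linter.dupNamespace false

open MeasureTheory Set Filter Topology
open scoped InnerProductSpace RealInnerProductSpace

namespace Summit.AnomalousDissipation.AnomalousDissipation.Theorems

open Literature.Analysis.FluidPDE Literature.Analysis.FluidPDE.Torus
open Literature.Analysis.FunctionSpaces Literature.Analysis.FunctionSpaces.Torus

namespace DopplerWork

/-! ### Character algebra on `T³` -/

/-- `sin · sin` product-to-sum at the level of characters: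
`Im e_k · Im e_l = ½ (Re e_{k−l} − Re e_{k+l})`. [folklore] -/
theorem im_mul_im_mFourier (k l : Fin 3 → ℤ) (x : UnitAddTorus (Fin 3)) :
    (UnitAddTorus.mFourier k x).im * (UnitAddTorus.mFourier l x).im =
      2⁻¹ * ((UnitAddTorus.mFourier (k - l) x).re - (UnitAddTorus.mFourier (k + l) x).re) := by
  rw [sub_eq_add_neg k l, UnitAddTorus.mFourier_add, UnitAddTorus.mFourier_add,
    UnitAddTorus.mFourier_neg]
  simp only [Complex.mul_re, Complex.conj_re, Complex.conj_im]
  ring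

/-- `|e_k|² = 1`: `(Re e_k)² + (Im e_k)² = 1` (`e_k e_{−k} = e_0 = 1`). [folklore] -/
theorem re_sq_add_im_sq_mFourier (k : Fin 3 → ℤ) (x : UnitAddTorus (Fin 3)) :
    (UnitAddTorus.mFourier k x).re ^ 2 + (UnitAddTorus.mFourier k x).im ^ 2 = 1 := by
  have h : UnitAddTorus.mFourier k x * UnitAddTorus.mFourier (-k) x = 1 := by
    rw [← UnitAddTorus.mFourier_add, add_neg_cancel, UnitAddTorus.mFourier_zero]
    rfl
  rw [UnitAddTorus.mFourier_neg, Complex.mul_conj] at h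
  have h' : Complex.normSq (UnitAddTorus.mFourier k x) = 1 := by exact_mod_cast h
  rw [Complex.normSq_apply] at h'
  nlinarith [h']

/-- The force–pattern pairing density as a combination of sines:
`F · (Im e_k)² · Re e_l · Im e_l = F/4 · Im e_{2l} − F/8 · (Im e_{2l+2k} + Im e_{2l−2k})`. [folklore] -/
theorem force_mul_pattern (F : ℝ) (k l : Fin 3 → ℤ) (x : UnitAddTorus (Fin 3)) :
    F * (UnitAddTorus.mFourier k x).im * (UnitAddTorus.mFourier l x).re *
        ((UnitAddTorus.mFourier k x).im * (UnitAddTorus.mFourier l x).im) =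
      F / 4 * (UnitAddTorus.mFourier (l + l) x).im -
        F / 8 * ((UnitAddTorus.mFourier ((l + l) + (k + k)) x).im +
          (UnitAddTorus.mFourier ((l + l) - (k + k)) x).im) := by
  have hn := re_sq_add_im_sq_mFourier k x
  rw [sub_eq_add_neg (l + l) (k + k)]
  simp only [UnitAddTorus.mFourier_add, UnitAddTorus.mFourier_neg, map_mul, Complex.mul_im,
    Complex.mul_re, Complex.conj_re, Complex.conj_im]
  linear_combination (F / 2 * (UnitAddTorus.mFourier l x).re * (UnitAddTorus.mFourier l x).im) * hn

/-- `∫ Im e_k = 0` for every frequency `k` (`∫ e_k = δ_{k0}` and `Im 1 = 0`). [folklore] -/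
theorem integral_im_mFourier (k : Fin 3 → ℤ) :
    ∫ x : UnitAddTorus (Fin 3), (UnitAddTorus.mFourier k x).im = 0 := by
  have hint : Integrable (⇑(UnitAddTorus.mFourier k)) (volume : Measure (UnitAddTorus (Fin 3))) :=
    (UnitAddTorus.mFourier k).continuous.integrable_unitAddTorus
  have h := Complex.imCLM.integral_comp_comm hint
  simp only [Complex.imCLM_apply] at h
  rw [h, integral_mFourier]
  split_ifs <;> simp

/-- **The force does no work on the quadrature pattern**: `∫ ⟪f, Ψ_s⟫ = 0` for
`f = (F · Im e_k · Re e_l) e₀`, `Ψ_s = (Im e_k · Im e_l) e₀`. [folklore] -/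
theorem integral_inner_force_pattern (F : ℝ) (k l : Fin 3 → ℤ) :
    ∫ x : UnitAddTorus (Fin 3),
      ⟪(F * (UnitAddTorus.mFourier k x).im * (UnitAddTorus.mFourier l x).re) •
          EuclideanSpace.single (0 : Fin 3) (1 : ℝ),
        ((UnitAddTorus.mFourier k x).im * (UnitAddTorus.mFourier l x).im) •
          EuclideanSpace.single (0 : Fin 3) (1 : ℝ)⟫ = 0 := by
  have hpt : ∀ x : UnitAddTorus (Fin 3),
      ⟪(F * (UnitAddTorus.mFourier k x).im * (UnitAddTorus.mFourier l x).re) •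
          EuclideanSpace.single (0 : Fin 3) (1 : ℝ),
        ((UnitAddTorus.mFourier k x).im * (UnitAddTorus.mFourier l x).im) •
          EuclideanSpace.single (0 : Fin 3) (1 : ℝ)⟫ =
      F / 4 * (UnitAddTorus.mFourier (l + l) x).im -
        F / 8 * ((UnitAddTorus.mFourier ((l + l) + (k + k)) x).im +
          (UnitAddTorus.mFourier ((l + l) - (k + k)) x).im) := by
    intro x
    have h0 : ⟪EuclideanSpace.single (0 : Fin 3) (1 : ℝ), EuclideanSpace.single (0 : Fin 3) (1 : ℝ)⟫ = 1 := by
      simp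
    rw [real_inner_smul_left, real_inner_smul_right, h0, mul_one, ← force_mul_pattern]
  have hc : ∀ p : Fin 3 → ℤ, Integrable (fun x : UnitAddTorus (Fin 3) => (UnitAddTorus.mFourier p x).im)
      (volume : Measure (UnitAddTorus (Fin 3))) := fun p =>
    (Complex.continuous_im.comp (UnitAddTorus.mFourier p).continuous).integrable_unitAddTorus
  have i1 : Integrable (fun x : UnitAddTorus (Fin 3) => F / 4 * (UnitAddTorus.mFourier (l + l) x).im)
      (volume : Measure (UnitAddTorus (Fin 3))) := (hc _).const_mul _
  have i2 : Integrable (fun x : UnitAddTorus (Fin 3) =>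
      F / 8 * ((UnitAddTorus.mFourier ((l + l) + (k + k)) x).im +
        (UnitAddTorus.mFourier ((l + l) - (k + k)) x).im)) (volume : Measure (UnitAddTorus (Fin 3))) :=
    ((hc _).add (hc _)).const_mul _
  have i3 : Integrable (fun x : UnitAddTorus (Fin 3) =>
      (UnitAddTorus.mFourier ((l + l) + (k + k)) x).im + (UnitAddTorus.mFourier ((l + l) - (k + k)) x).im)
      (volume : Measure (UnitAddTorus (Fin 3))) := (hc _).add (hc _)
  simp_rw [hpt]
  rw [integral_sub i1 i2, integral_const_mul, integral_const_mul, integral_add (hc _) (hc _),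
    integral_im_mFourier, integral_im_mFourier, integral_im_mFourier]
  ring

/-! ### The quadrature streak pattern `Ψ_s = (Im e_M · Im e_N) e₀` -/

/-- `(Im e_k · Im e_l) a = ½ (stokesMode (k−l) a cos + stokesMode (k+l) (−a) cos)`. [folklore] -/
theorem pattern_eq_stokesModes (k l : Fin 3 → ℤ) (a : EuclideanSpace ℝ (Fin 3)) :
    (fun y : UnitAddTorus (Fin 3) =>
        ((UnitAddTorus.mFourier k y).im * (UnitAddTorus.mFourier l y).im) • a) =
      fun x => (2⁻¹ : ℝ) • (stokesMode (k - l) a true x + stokesMode (k + l) (-a) true x) := by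
  funext x
  rw [im_mul_im_mFourier, mul_smul, sub_smul]
  simp [stokesMode_apply, sub_eq_add_neg]

/-- **Regularity of the streak pattern**: `Ψ_s = sin(2πm x₁) sin(2πn x₂) e₀` is smooth, divergence
free and a `Δ`-eigenfield, `ΔΨ_s = −4π²(m²+n²) Ψ_s` (two cosine Stokes modes at `(0, m, ∓n)`,
transversal amplitude `e₀`; Constantin–Foias 1988, Ch. 4, (4.13)–(4.14), (4.33)). [folklore] -/
theorem pattern_regular (m n : ℕ) :
    IsSmooth (fun y : UnitAddTorus (Fin 3) =>
        ((UnitAddTorus.mFourier (Pi.single (1 : Fin 3) (m : ℤ)) y).im *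
          (UnitAddTorus.mFourier (Pi.single (2 : Fin 3) (n : ℤ)) y).im) •
          EuclideanSpace.single (0 : Fin 3) (1 : ℝ)) ∧
      IsDivFree (fun y : UnitAddTorus (Fin 3) =>
        ((UnitAddTorus.mFourier (Pi.single (1 : Fin 3) (m : ℤ)) y).im *
          (UnitAddTorus.mFourier (Pi.single (2 : Fin 3) (n : ℤ)) y).im) •
          EuclideanSpace.single (0 : Fin 3) (1 : ℝ)) ∧
      ∀ x, laplacian (fun y : UnitAddTorus (Fin 3) =>
        ((UnitAddTorus.mFourier (Pi.single (1 : Fin 3) (m : ℤ)) y).im *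
          (UnitAddTorus.mFourier (Pi.single (2 : Fin 3) (n : ℤ)) y).im) •
          EuclideanSpace.single (0 : Fin 3) (1 : ℝ)) x =
        -((4 * Real.pi ^ 2 * ((m : ℝ) ^ 2 + (n : ℝ) ^ 2)) •
          ((UnitAddTorus.mFourier (Pi.single (1 : Fin 3) (m : ℤ)) x).im *
            (UnitAddTorus.mFourier (Pi.single (2 : Fin 3) (n : ℤ)) x).im) •
            EuclideanSpace.single (0 : Fin 3) (1 : ℝ)) := by
  have e₁ : stokesEigenvalue (Pi.single (1 : Fin 3) (m : ℤ) - Pi.single (2 : Fin 3) (n : ℤ)) =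
      4 * Real.pi ^ 2 * ((m : ℝ) ^ 2 + (n : ℝ) ^ 2) := by
    rw [AcdcDesign.stokesEigenvalue_fin_three]
    simp
  have e₂ : stokesEigenvalue (Pi.single (1 : Fin 3) (m : ℤ) + Pi.single (2 : Fin 3) (n : ℤ)) =
      4 * Real.pi ^ 2 * ((m : ℝ) ^ 2 + (n : ℝ) ^ 2) := by
    rw [AcdcDesign.stokesEigenvalue_fin_three]
    simp
  have t₁ : ⟪latticeVec (Pi.single (1 : Fin 3) (m : ℤ) - Pi.single (2 : Fin 3) (n : ℤ)),
      EuclideanSpace.single (0 : Fin 3) (1 : ℝ)⟫ = 0 := by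
    rw [AcdcDesign.inner_latticeVec_fin_three]
    simp
  have t₂ : ⟪latticeVec (Pi.single (1 : Fin 3) (m : ℤ) + Pi.single (2 : Fin 3) (n : ℤ)),
      -EuclideanSpace.single (0 : Fin 3) (1 : ℝ)⟫ = 0 := by
    rw [inner_neg_right, AcdcDesign.inner_latticeVec_fin_three]
    simp
  have hPat := pattern_eq_stokesModes (Pi.single (1 : Fin 3) (m : ℤ)) (Pi.single (2 : Fin 3) (n : ℤ))
    (EuclideanSpace.single (0 : Fin 3) (1 : ℝ))
  rw [hPat]
  obtain ⟨hs, hΔ⟩ := AcdcDesign.eig_smul (AcdcDesign.eig_add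
    (AcdcDesign.eig_mode (EuclideanSpace.single (0 : Fin 3) (1 : ℝ)) true e₁)
    (AcdcDesign.eig_mode (-EuclideanSpace.single (0 : Fin 3) (1 : ℝ)) true e₂)) (2⁻¹ : ℝ)
  refine ⟨hs, ?_, fun x => ?_⟩
  · exact AcdcDesign.isDivFree_const_smul'
      ((isSmooth_stokesMode _ _ true).add (isSmooth_stokesMode _ _ true))
      (AcdcDesign.isDivFree_add' (isSmooth_stokesMode _ _ true) (isSmooth_stokesMode _ _ true)
        (isDivFree_stokesMode t₁ true) (isDivFree_stokesMode t₂ true)) 2⁻¹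
  · rw [hΔ x]
    have hx := congrFun hPat x
    rw [hx]

/-- The streak pattern is transversal to the drift direction: `(Ψ_s)₂ ≡ 0`. [folklore] -/
theorem pattern_apply_two (a b : ℝ) :
    ((a * b) • EuclideanSpace.single (0 : Fin 3) (1 : ℝ)) (2 : Fin 3) = 0 := by
  simp

/-- **The drift derivative of the streak pattern**: `∂₂ Ψ_s = 2πn Ψ_c` with
`Ψ_c = sin(2πm x₁) cos(2πn x₂) e₀ = (Im e_M · Re e_N) e₀` (`∂ⱼ Im e_l = 2π lⱼ Re e_l`,
Grafakos 2014, Prop. 3.2.6). [folklore] -/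
theorem partialDeriv_two_pattern (m n : ℕ) (x : UnitAddTorus (Fin 3)) :
    partialDeriv 2 (fun y : UnitAddTorus (Fin 3) =>
        ((UnitAddTorus.mFourier (Pi.single (1 : Fin 3) (m : ℤ)) y).im *
          (UnitAddTorus.mFourier (Pi.single (2 : Fin 3) (n : ℤ)) y).im) •
          EuclideanSpace.single (0 : Fin 3) (1 : ℝ)) x =
      (2 * Real.pi * n * ((UnitAddTorus.mFourier (Pi.single (1 : Fin 3) (m : ℤ)) x).im *
          (UnitAddTorus.mFourier (Pi.single (2 : Fin 3) (n : ℤ)) x).re)) •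
        EuclideanSpace.single (0 : Fin 3) (1 : ℝ) := by
  have hM1 : IsContDiff 1 (fun y : UnitAddTorus (Fin 3) =>
      (UnitAddTorus.mFourier (Pi.single (1 : Fin 3) (m : ℤ)) y).im) :=
    (AcdcDesign.isSmooth_im_mFourier _).isContDiff (by simp)
  have hN1 : IsContDiff 1 (fun y : UnitAddTorus (Fin 3) =>
      (UnitAddTorus.mFourier (Pi.single (2 : Fin 3) (n : ℤ)) y).im) :=
    (AcdcDesign.isSmooth_im_mFourier _).isContDiff (by simp)
  have hprod : IsContDiff 1 (fun y : UnitAddTorus (Fin 3) =>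
      (UnitAddTorus.mFourier (Pi.single (1 : Fin 3) (m : ℤ)) y).im *
        (UnitAddTorus.mFourier (Pi.single (2 : Fin 3) (n : ℤ)) y).im) := by
    exact ContDiff.mul hM1 hN1
  have hconst : partialDeriv 2 (fun _ : UnitAddTorus (Fin 3) => EuclideanSpace.single (0 : Fin 3) (1 : ℝ)) x = 0 := by
    simp [Torus.partialDeriv, Torus.lineDeriv]
  rw [partialDeriv_smul hprod (isContDiff_const _), hconst, smul_zero, zero_add,
    partialDeriv_mul hM1 hN1, AcdcDesign.partialDeriv_im_mFourier, AcdcDesign.partialDeriv_im_mFourier]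
  simp only [Pi.single_eq_same, Pi.single_eq_of_ne (show (2 : Fin 3) ≠ 1 by decide)]
  push_cast
  ring_nf

/-- **Smoothness of the swept Doppler pair** `f = F sin(2πm x₁) cos(2πn x₂) e₀`. [folklore] -/
theorem force_isSmooth (F : ℝ) (k l : Fin 3 → ℤ) :
    IsSmooth (fun x : UnitAddTorus (Fin 3) =>
      (F * (UnitAddTorus.mFourier k x).im * (UnitAddTorus.mFourier l x).re) •
        EuclideanSpace.single (0 : Fin 3) (1 : ℝ)) := by
  have him := AcdcDesign.isSmooth_im_mFourier k
  have hre := AcdcDesign.isSmooth_re_mFourier l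
  exact ((contDiff_const.mul him).mul hre).smul contDiff_const

/-- Continuity of the conjugate pattern `Ψ_c = sin(2πm x₁) cos(2πn x₂) e₀`. [folklore] -/
theorem copattern_continuous (k l : Fin 3 → ℤ) :
    Continuous (fun x : UnitAddTorus (Fin 3) =>
      ((UnitAddTorus.mFourier k x).im * (UnitAddTorus.mFourier l x).re) •
        EuclideanSpace.single (0 : Fin 3) (1 : ℝ)) :=
  ((Complex.continuous_im.comp (UnitAddTorus.mFourier k).continuous).mul
    (Complex.continuous_re.comp (UnitAddTorus.mFourier l).continuous)).smul continuous_const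

end DopplerWork

/-- **`DopplerClock.DopplerWorkIdentity` holds** (item stmt-AnomalousDissipation-18133): for every
generalized limit `Λ`, `V, ν > 0`, `n ≥ 1`, and every global Leray–Hopf solution `u` of `NS_ν` on
`T³` forced by the swept Doppler pair `f = F sin(2πm x₁) cos(2πn x₂) e₀` with
`sup_{t ≥ 0} ½‖u(t)‖₂² < ∞`,
`Λ⟨(f,u)⟩ = F/(V·2πn) · (ν · 4π²(m²+n²) · Λ⟨(Ψ_s,u)⟩ − Λ⟨∫⟪w,(w·∇)Ψ_s⟫⟩)`, `w = u − V e₂`,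
`Ψ_s = sin(2πm x₁) sin(2πn x₂) e₀`: the mean momentum balance (`meanMomentumBalance_proof`) tested
with `Ψ_s` (`ΔΨ_s = −κ²Ψ_s`, `(f,Ψ_s) = 0`), the Galilean split
`⟪u,(u·∇)Ψ_s⟫ = ⟪w,(w·∇)Ψ_s⟫ + 2πnV ⟪u,Ψ_c⟫` (`∂₂Ψ_s = 2πn Ψ_c`), linearity of `Λ⟨·⟩` on
interval-integrable functions, and `(f,u) = F (u,Ψ_c)` (Foias–Manley–Rosa–Temam 2001, Ch. IV §3.1;
Doering–Foias 2002 §2). The momentum hypothesis is not used. [folklore] -/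
theorem dopplerWorkIdentity_proof :
    Summit.AnomalousDissipation.AnomalousDissipation.Theses.DopplerClock.DopplerWorkIdentity := by
  unfold Summit.AnomalousDissipation.AnomalousDissipation.Theses.DopplerClock.DopplerWorkIdentity
  intro Λ F V ν m n u₀ u hV hν hn hu _hmom hE
  -- the design facts (explicit forms, abstracted by the `set`s below)
  have hfs := DopplerWork.force_isSmooth F (Pi.single (1 : Fin 3) (m : ℤ)) (Pi.single (2 : Fin 3) (n : ℤ))
  obtain ⟨hΨs_s, hΨs_div, -⟩ := DopplerWork.pattern_regular m n
  have hΔ : ∀ x, laplacian (fun y : UnitAddTorus (Fin 3) =>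
      ((UnitAddTorus.mFourier (Pi.single (1 : Fin 3) (m : ℤ)) y).im *
        (UnitAddTorus.mFourier (Pi.single (2 : Fin 3) (n : ℤ)) y).im) •
        EuclideanSpace.single (0 : Fin 3) (1 : ℝ)) x =
      -((4 * Real.pi ^ 2 * ((m : ℝ) ^ 2 + (n : ℝ) ^ 2)) •
        (fun y : UnitAddTorus (Fin 3) =>
          ((UnitAddTorus.mFourier (Pi.single (1 : Fin 3) (m : ℤ)) y).im *
            (UnitAddTorus.mFourier (Pi.single (2 : Fin 3) (n : ℤ)) y).im) •
            EuclideanSpace.single (0 : Fin 3) (1 : ℝ)) x) :=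
    fun x => (DopplerWork.pattern_regular m n).2.2 x
  have hΨc_c := DopplerWork.copattern_continuous (Pi.single (1 : Fin 3) (m : ℤ)) (Pi.single (2 : Fin 3) (n : ℤ))
  have hV0 : ∀ y, (fun y : UnitAddTorus (Fin 3) =>
      ((UnitAddTorus.mFourier (Pi.single (1 : Fin 3) (m : ℤ)) y).im *
        (UnitAddTorus.mFourier (Pi.single (2 : Fin 3) (n : ℤ)) y).im) •
        EuclideanSpace.single (0 : Fin 3) (1 : ℝ)) y 2 = 0 :=
    fun y => DopplerWork.pattern_apply_two _ _
  have hC0 : ∀ y, (fun y : UnitAddTorus (Fin 3) =>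
      ((UnitAddTorus.mFourier (Pi.single (1 : Fin 3) (m : ℤ)) y).im *
        (UnitAddTorus.mFourier (Pi.single (2 : Fin 3) (n : ℤ)) y).re) •
        EuclideanSpace.single (0 : Fin 3) (1 : ℝ)) y 2 = 0 :=
    fun y => DopplerWork.pattern_apply_two _ _
  have hd : ∀ y, partialDeriv 2 (fun y : UnitAddTorus (Fin 3) =>
      ((UnitAddTorus.mFourier (Pi.single (1 : Fin 3) (m : ℤ)) y).im *
        (UnitAddTorus.mFourier (Pi.single (2 : Fin 3) (n : ℤ)) y).im) •
        EuclideanSpace.single (0 : Fin 3) (1 : ℝ)) y =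
      (fun _ : UnitAddTorus (Fin 3) => 2 * Real.pi * n) y •
        (fun y : UnitAddTorus (Fin 3) =>
          ((UnitAddTorus.mFourier (Pi.single (1 : Fin 3) (m : ℤ)) y).im *
            (UnitAddTorus.mFourier (Pi.single (2 : Fin 3) (n : ℤ)) y).re) •
            EuclideanSpace.single (0 : Fin 3) (1 : ℝ)) y := fun y => by
    beta_reduce
    rw [DopplerWork.partialDeriv_two_pattern, smul_smul]
  -- the design: force `f`, streak pattern `Ψs`, conjugate pattern `Ψc`
  set f : UnitAddTorus (Fin 3) → EuclideanSpace ℝ (Fin 3) := fun x =>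
    (F * (UnitAddTorus.mFourier (Pi.single (1 : Fin 3) (m : ℤ)) x).im *
      (UnitAddTorus.mFourier (Pi.single (2 : Fin 3) (n : ℤ)) x).re) •
      EuclideanSpace.single (0 : Fin 3) (1 : ℝ) with hf
  set Ψs : UnitAddTorus (Fin 3) → EuclideanSpace ℝ (Fin 3) := fun y =>
    ((UnitAddTorus.mFourier (Pi.single (1 : Fin 3) (m : ℤ)) y).im *
      (UnitAddTorus.mFourier (Pi.single (2 : Fin 3) (n : ℤ)) y).im) •
      EuclideanSpace.single (0 : Fin 3) (1 : ℝ) with hΨs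
  set Ψc : UnitAddTorus (Fin 3) → EuclideanSpace ℝ (Fin 3) := fun y =>
    ((UnitAddTorus.mFourier (Pi.single (1 : Fin 3) (m : ℤ)) y).im *
      (UnitAddTorus.mFourier (Pi.single (2 : Fin 3) (n : ℤ)) y).re) •
      EuclideanSpace.single (0 : Fin 3) (1 : ℝ) with hΨc
  set lam : ℝ := 4 * Real.pi ^ 2 * ((m : ℝ) ^ 2 + (n : ℝ) ^ 2) with hlam
  have hmem : ∀ t : ℝ, 0 ≤ t → MemLp (u t) 2 volume := fun t ht =>
    (hu (t + 1) (by linarith)).memLp t ⟨ht, by linarith⟩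
  -- the mean momentum balance tested with `Ψs` (item stmt-AnomalousDissipation-1773)
  have hMB := meanMomentumBalance_proof Λ ν f Ψs u₀ u hν hfs hΨs_s hΨs_div hu hE
  -- the force does no work on `Ψs`
  have hfΨ : ∫ x, ⟪f x, Ψs x⟫ = 0 := DopplerWork.integral_inner_force_pattern F _ _
  -- the viscous pairing: `ΔΨs = -lam Ψs`
  have hlap : (fun t => ∫ x, ⟪u t x, laplacian Ψs x⟫) = fun t => -lam * ∫ x, ⟪Ψs x, u t x⟫ := by
    funext t
    rw [← integral_const_mul]
    refine integral_congr_ae (ae_of_all _ fun x => ?_)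
    dsimp only
    rw [hΔ x, inner_neg_right, real_inner_smul_right, real_inner_comm]
    ring
  rw [hlap, GridInjection.longTimeAvg_const_mul, hfΨ, add_zero] at hMB
  -- the Galilean split of the convective pairing, `t ≥ 0`
  have h1 : ∀ t : ℝ, 0 ≤ t → (∫ x, ⟪u t x, convect (u t) Ψs x⟫) =
      (∫ x, ⟪u t x - V • EuclideanSpace.single 2 1,
        convect (fun y => u t y - V • EuclideanSpace.single 2 1) Ψs x⟫) +
        2 * Real.pi * n * V * ∫ x, ⟪u t x, Ψc x⟫ := by
    intro t ht
    rw [GridInjection.integral_inner_convect_eq_shift hΨs_s hΨc_c continuous_const hV0 hC0 hd V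
      (hmem t ht), integral_const_mul]
    ring
  -- interval integrability of the pieces
  have hB : ∀ T, 0 < T → IntervalIntegrable (fun t => ∫ x, ⟪u t x, Ψc x⟫) volume 0 T :=
    fun T hT => GridInjection.intervalIntegrable_inner hu hΨc_c hT
  have hB' : ∀ T, 0 < T → IntervalIntegrable
      (fun t => 2 * Real.pi * n * V * ∫ x, ⟪u t x, Ψc x⟫) volume 0 T :=
    fun T hT => (hB T hT).const_mul _
  have hA : ∀ T, 0 < T → IntervalIntegrable (fun t => ∫ x, ⟪u t x - V • EuclideanSpace.single 2 1,
      convect (fun y => u t y - V • EuclideanSpace.single 2 1) Ψs x⟫) volume 0 T := by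
    intro T hT
    have h := (GridInjection.intervalIntegrable_inner_convect (hfs.memLp 2) hu hΨs_s hT).sub (hB' T hT)
    refine h.congr fun t ht => ?_
    rw [uIoc_of_le hT.le] at ht
    show (∫ x, ⟪u t x, convect (u t) Ψs x⟫) - 2 * Real.pi * n * V * ∫ x, ⟪u t x, Ψc x⟫ = _
    rw [h1 t ht.1.le]
    ring
  -- linearity of the generalized long-time average
  have hsplit : Λ.longTimeAvg (fun t => ∫ x, ⟪u t x, convect (u t) Ψs x⟫) =
      Λ.longTimeAvg (fun t => ∫ x, ⟪u t x - V • EuclideanSpace.single 2 1,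
        convect (fun y => u t y - V • EuclideanSpace.single 2 1) Ψs x⟫) +
        2 * Real.pi * n * V * Λ.longTimeAvg (fun t => ∫ x, ⟪u t x, Ψc x⟫) := by
    rw [Λ.longTimeAvg_congr (fun t ht => h1 t ht.le), GridInjection.longTimeAvg_add Λ hA hB',
      GridInjection.longTimeAvg_const_mul]
  rw [hsplit] at hMB
  -- the injection is `F` times the conjugate amplitude
  have hinj : (fun t => ∫ x, ⟪f x, u t x⟫) = fun t => F * ∫ x, ⟪u t x, Ψc x⟫ := by
    funext t
    rw [← integral_const_mul]
    refine integral_congr_ae (ae_of_all _ fun x => ?_)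
    dsimp only
    simp only [hf, hΨc, real_inner_smul_left, real_inner_smul_right]
    rw [real_inner_comm]
    ring
  rw [hinj, GridInjection.longTimeAvg_const_mul]
  -- algebra
  have hπ : Real.pi ≠ 0 := Real.pi_ne_zero
  have hn' : (n : ℝ) ≠ 0 := by exact_mod_cast hn.ne'
  have hV' : V ≠ 0 := hV.ne'
  field_simp
  linear_combination (F) * hMB

end Summit.AnomalousDissipation.AnomalousDissipation.Theorems

end
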